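import Literature.MathematicalPhysics.QuantumManyBody.TorusFockSectorInteraction
import HarnessLib

/-!
# Galerkin scattering data on a finite momentum band: the minimiser of
# `E(c) = ∑_p ε_p c_p² + (2L³)⁻¹ [W(0) - 2∑_q W(q)c_q + ∑_{p,q} W(p-q)c_pc_q]`,
# its Euler–Lagrange equations (the scattering equation with zero defect), the energy identity
# `E(c) = (2L³)⁻¹ [W(0) - ∑_q W(q) c_q]` and the a priori bounds

Topic `Literature/MathematicalPhysics/QuantumManyBody`. Input data for the trial state of the
provefact `Literature.MathematicalPhysics.QuantumManyBody.BoseGas.BastiCenatiempoSchlein2021_upperBound`.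
[BastiCenatiempoSchlein2021, (2.3)–(2.5)] take the correlation kernel `η_p = -N ŵ_N(p)` from the
Neumann ground state `f_ℓ` of `-Δ + ½V` on a ball (Lemma 2.1, from [BBCS3]) and use it through
(a) the scattering equation (2.5)
`p²η_p + ½N^κV̂(p/N^{1-κ}) + (2N)⁻¹∑_q N^κV̂((p-q)/N^{1-κ})η_q = N^{3-2κ}λ_ℓ(χ̂_ℓ * f̂_N)(p)`,
(b) the bounds `|η_p| ≤ CN^κ/p²` (2.4), `‖η‖²_{H¹} ≤ CN^{1+κ}` (Lemma 2.2), and (c) the value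
`∫Vf_ℓ = 8π𝔞 + O(𝔞²/ℓN^{1-κ})` (Lemma 2.1 (ii)). Since the kernel only parametrises a *trial*
state, we replace `f_ℓ` by the **Galerkin minimiser** on the finite set of modes actually used
(coefficient space `ι → ℝ`, momenta `e : ι → ℤ³`, kinetic weights `ε_p = |2πe(p)/L|²`, pair
coefficients `W = W_L = potFT v L`): for the functional
`E(c) = ∑_p ε_p c_p² + (2L³)⁻¹ Q(c)`, `Q(c) = W(0) - 2∑_q W(e q)c_q + ∑_{p,q} W(e p - e q)c_pc_q`
(`= (2L³)⁻¹∫_Λ v_per (1 - w)²` for `w = ∑ c_p e_p`), this file proves, in finite dimensions only: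

* `exists_isMinOn_galerkinEnergy`: a minimiser exists when `ε > 0` and `Q ≥ 0` (coercivity);
* `galerkin_euler_lagrange`: at a minimiser, for every mode `p`,
  `2L³ε_p c_p = W(e p) - ∑_q W(e p - e q) c_q` — the analogue of (2.5) with **zero right-hand side**
  (no `λ_ℓ`, no `χ_ℓ`), exactly, on every mode of the band;
* `galerkinEnergy_eq_of_euler_lagrange`: the energy identity `E(c) = (2L³)⁻¹(W(0) - ∑_q W(e q)c_q)`
  (stationarity along `c` itself), i.e. the functional value *is* `½L⁻³ "∫v f"`, `f = 1 - w`, the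
  quantity entering the leading term of the energy — so Lemma 2.1 (ii) is replaced by the single
  variational comparison `E(c_G) ≤ E(c_trial)`;
* `sum_eps_mul_sq_le` and `abs_eps_mul_le`: the a priori bounds
  `∑_p ε_pc_p² ≤ (2L³)⁻²∑_p W(e p)²/ε_p` and
  `2L³ε_p|c_p| ≤ |W(e p)| + (∑_q W(e p - e q)²/ε_q)^{1/2}(∑_q ε_qc_q²)^{1/2}` from the equation and
  the positivity `∑_{p,q} W(e p - e q)c_pc_q ≥ 0` (Bochner: `= ∫v|∑c_pe_p|² ≥ 0`, proved here from
  `potFT` for `v ≥ 0` with `∫v < ∞`, `sum_sum_re_potFT_mul_mul_nonneg`, and `galerkinPot_re_potFT_nonneg`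
  for the full form `Q ≥ 0` via the extra mode `e = 0` on `Option ι`), which give (2.4) and
  Lemma 2.2's `H¹` bound with explicit constants and without any maximum principle or PDE regularity.

* **Even minimiser** (appended): `E(c ∘ σ) = E(c)` for a mode bijection `σ` with `e ∘ σ = -e`,
  `ε ∘ σ = ε`, `W` even (`galerkinEnergy_comp`); midpoint convexity from Bochner positivity
  (`galerkinEnergy_midpoint_le`) and affinity of the Euler–Lagrange system (`euler_lagrange_midpoint`)
  give an even minimiser satisfying the scattering equation (`exists_even_minimiser`: `η_{-p} = η_p`,
  needed for the pair structure of the Bogoliubov transformation).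

## References

* [BastiCenatiempoSchlein2021] G. Basti, S. Cenatiempo, B. Schlein, Forum Math. Sigma 9 (2021) e74,
  arXiv:2101.06222: (2.3)–(2.5), Lemma 2.1, Lemma 2.2, (2.4).
* [LSSY2005] E. H. Lieb, R. Seiringer, J. P. Solovej, J. Yngvason, *The Mathematics of the Bose Gas
  and its Condensation* (2005), App. C (variational scattering length).
-/

noncomputable section

namespace Literature.MathematicalPhysics.QuantumManyBody.BoseGas

open Complex Finset MeasureTheory Filter
open scoped BigOperators ENNReal Topology ComplexConjugate

section Galerkin

variable {ι : Type*} [Fintype ι] [DecidableEq ι]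

/-- The **potential form** `Q(c) = W(0) - 2∑_q W(e q)c_q + ∑_{p,q} W(e p - e q)c_pc_q`
(`= ∫ v_per (1 - w)²`-type quantity of the band function `w = ∑ c_pe_p`).
[cite: BastiCenatiempoSchlein2021, (2.3) (`[-Δ + ½V]f`), (2.5)] -/
def galerkinPot (e : ι → Momentum) (W : Momentum → ℝ) (c : ι → ℝ) : ℝ :=
  W 0 - 2 * ∑ q, W (e q) * c q + ∑ p, ∑ q, W (e p - e q) * c p * c q

/-- The **Galerkin scattering energy** `E(c) = ∑_p ε_pc_p² + (2L³)⁻¹ Q(c)` on the coefficient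
space of the band. [cite: BastiCenatiempoSchlein2021, (2.3)–(2.5)] -/
def galerkinEnergy (e : ι → Momentum) (ε : ι → ℝ) (W : Momentum → ℝ) (L : ℝ) (c : ι → ℝ) : ℝ :=
  ∑ p, ε p * c p ^ 2 + (2 * L ^ 3)⁻¹ * galerkinPot e W c

variable {e : ι → Momentum} {ε : ι → ℝ} {W : Momentum → ℝ} {L : ℝ}

omit [DecidableEq ι] in
/-- `E` is continuous on the coefficient space. [folklore] -/
theorem continuous_galerkinEnergy (e : ι → Momentum) (ε : ι → ℝ) (W : Momentum → ℝ) (L : ℝ) :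
    Continuous (galerkinEnergy e ε W L) := by
  unfold galerkinEnergy galerkinPot
  fun_prop

omit [DecidableEq ι] in
/-- Coercivity: `E(c) ≥ m ‖c‖²` when `ε ≥ m > 0`, `Q ≥ 0`, `L > 0` (sup norm on `ι → ℝ`). [folklore] -/
theorem galerkinEnergy_ge (hL : 0 < L) {m : ℝ} (hm0 : 0 < m) (hm : ∀ p, m ≤ ε p)
    (hQ : ∀ c, 0 ≤ galerkinPot e W c) (c : ι → ℝ) : m * ‖c‖ ^ 2 ≤ galerkinEnergy e ε W L c := by
  unfold galerkinEnergy
  have h1 : m * ‖c‖ ^ 2 ≤ ∑ p, ε p * c p ^ 2 := by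
    rcases isEmpty_or_nonempty ι with hι | hι
    · simp [Pi.norm_def, Finset.univ_eq_empty]
    obtain ⟨p₀, _, hp₀⟩ := Finset.exists_mem_eq_sup (Finset.univ : Finset ι) Finset.univ_nonempty
      (fun p => ‖c p‖₊)
    have hnorm : ‖c‖ = |c p₀| := by
      rw [Pi.norm_def, hp₀, coe_nnnorm, Real.norm_eq_abs]
    calc m * ‖c‖ ^ 2 = m * c p₀ ^ 2 := by rw [hnorm, sq_abs]
      _ ≤ ε p₀ * c p₀ ^ 2 := mul_le_mul_of_nonneg_right (hm p₀) (sq_nonneg _)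
      _ ≤ ∑ p, ε p * c p ^ 2 :=
          Finset.single_le_sum (f := fun p => ε p * c p ^ 2)
            (fun p _ => mul_nonneg (hm0.le.trans (hm p)) (sq_nonneg _)) (Finset.mem_univ p₀)
  have h2 : 0 ≤ (2 * L ^ 3)⁻¹ * galerkinPot e W c := mul_nonneg (by positivity) (hQ c)
  linarith

omit [DecidableEq ι] in
/-- **A Galerkin minimiser exists** (`ε ≥ m > 0`, `Q ≥ 0`, `L > 0`; finite dimensions).
[cite: BastiCenatiempoSchlein2021, Lemma 2.1 (existence of the lowest-energy solution)] -/
theorem exists_isMinOn_galerkinEnergy (hL : 0 < L) {m : ℝ} (hm0 : 0 < m) (hm : ∀ p, m ≤ ε p)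
    (hQ : ∀ c, 0 ≤ galerkinPot e W c) :
    ∃ c₀ : ι → ℝ, ∀ c, galerkinEnergy e ε W L c₀ ≤ galerkinEnergy e ε W L c := by
  refine (continuous_galerkinEnergy e ε W L).exists_forall_le ?_
  have h1 : Tendsto (fun c : ι → ℝ => m * ‖c‖ ^ 2) (cocompact (ι → ℝ)) atTop :=
    ((tendsto_pow_atTop two_ne_zero).comp tendsto_norm_cocompact_atTop).const_mul_atTop hm0
  exact tendsto_atTop_mono (fun c => galerkinEnergy_ge hL hm0 hm hQ c) h1

/-! ### Euler–Lagrange: the scattering equation with zero defect -/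

/-- A real quadratic `t ↦ tD + t²A` that is `≥ 0` for all `t` has `D = 0`. [folklore] -/
theorem linear_coeff_eq_zero_of_nonneg {D A : ℝ} (h : ∀ t : ℝ, 0 ≤ t * D + t ^ 2 * A) : D = 0 := by
  by_contra hD
  -- test at `t = -D/(2(|A|+1))`
  set K := |A| + 1 with hK
  have hKpos : 0 < K := by positivity
  have h1 := h (-D / (2 * K))
  have hD2 : 0 < D ^ 2 := by positivity
  have hA : A ≤ K := (le_abs_self A).trans (by linarith)
  have : (-D / (2 * K)) * D + (-D / (2 * K)) ^ 2 * A ≤ (-D / (2 * K)) * D + (-D / (2 * K)) ^ 2 * K := by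
    have hsq : 0 ≤ (-D / (2 * K)) ^ 2 := sq_nonneg _
    nlinarith
  have h3 : (-D / (2 * K)) * D + (-D / (2 * K)) ^ 2 * K = -(D ^ 2) / (4 * K) := by
    field_simp; ring
  rw [h3] at this
  have h4 : -(D ^ 2) / (4 * K) < 0 := by
    apply div_neg_of_neg_of_pos (by linarith) (by positivity)
  linarith

/-- The variation of `E` along a coordinate: `E(c + tδ_p) = E(c) + t·D_p + t²·A_p` with
`D_p = 2ε_pc_p + (2L³)⁻¹(-2W(e p) + ∑_q (W(e p - e q) + W(e q - e p)) c_q)`. [folklore] -/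
theorem galerkinEnergy_add_single (c : ι → ℝ) (p : ι) (t : ℝ) :
    galerkinEnergy e ε W L (fun q => c q + if q = p then t else 0) = galerkinEnergy e ε W L c +
      t * (2 * ε p * c p + (2 * L ^ 3)⁻¹ * (-2 * W (e p) +
        ∑ q, (W (e p - e q) + W (e q - e p)) * c q)) +
      t ^ 2 * (ε p + (2 * L ^ 3)⁻¹ * W (e p - e p)) := by
  unfold galerkinEnergy galerkinPot
  -- the three sums, one at a time
  have h1 : ∑ q, ε q * (c q + if q = p then t else 0) ^ 2 =
      ∑ q, ε q * c q ^ 2 + (2 * ε p * c p * t + ε p * t ^ 2) := by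
    have : ∀ q, ε q * (c q + if q = p then t else 0) ^ 2 =
        ε q * c q ^ 2 + (if q = p then 2 * ε p * c p * t + ε p * t ^ 2 else 0) := by
      intro q
      by_cases h : q = p
      · rw [if_pos h, if_pos h, h]; ring
      · rw [if_neg h, if_neg h]; ring
    simp only [this, Finset.sum_add_distrib, Finset.sum_ite_eq', Finset.mem_univ, if_true]
  have h2 : ∑ q, W (e q) * (c q + if q = p then t else 0) = ∑ q, W (e q) * c q + W (e p) * t := by
    have : ∀ q, W (e q) * (c q + if q = p then t else 0) =
        W (e q) * c q + (if q = p then W (e p) * t else 0) := by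
      intro q
      by_cases h : q = p
      · rw [if_pos h, if_pos h, h]; ring
      · rw [if_neg h, if_neg h]; ring
    simp only [this, Finset.sum_add_distrib, Finset.sum_ite_eq', Finset.mem_univ, if_true]
  have h3 : ∑ a, ∑ b, W (e a - e b) * (c a + if a = p then t else 0) * (c b + if b = p then t else 0) =
      ∑ a, ∑ b, W (e a - e b) * c a * c b + (t * ∑ b, W (e p - e b) * c b) +
        (t * ∑ a, W (e a - e p) * c a) + t ^ 2 * W (e p - e p) := by
    have : ∀ a b, W (e a - e b) * (c a + if a = p then t else 0) * (c b + if b = p then t else 0) =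
        W (e a - e b) * c a * c b + (if a = p then t * (W (e p - e b) * c b) else 0) +
        (if b = p then t * (W (e a - e p) * c a) else 0) +
        (if a = p then (if b = p then t ^ 2 * W (e p - e p) else 0) else 0) := by
      intro a b
      by_cases ha : a = p
      · by_cases hb : b = p
        · simp only [ha, hb, if_true]; ring
        · simp only [ha, hb, if_true, if_false]; ring
      · by_cases hb : b = p
        · simp only [ha, hb, if_true, if_false]; ring
        · simp only [ha, hb, if_false]; ring
    simp only [this, Finset.sum_add_distrib, Finset.sum_ite_irrel, Finset.sum_const_zero,
      Finset.sum_ite_eq', Finset.mem_univ, if_true, ← Finset.mul_sum]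
  rw [h1, h2, h3]
  simp only [add_mul, Finset.sum_add_distrib]
  ring

/-- **The Euler–Lagrange equations of the Galerkin minimiser = the scattering equation with zero
defect on every mode**: for `W` even, at any minimiser `c`,
`2L³ε_p c_p = W(e p) - ∑_q W(e p - e q) c_q` for all `p` — the analogue of
`p²η_p + ½N^κV̂(p/N^{1-κ}) + (2N)⁻¹∑_qN^κV̂((p-q)/N^{1-κ})η_q = 0` [(2.5) with vanishing right
side]. [cite: BastiCenatiempoSchlein2021, (2.5)] -/
theorem galerkin_euler_lagrange (hL : 0 < L) (hW : ∀ k, W (-k) = W k) {c : ι → ℝ}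
    (hmin : ∀ c', galerkinEnergy e ε W L c ≤ galerkinEnergy e ε W L c') (p : ι) :
    2 * L ^ 3 * ε p * c p = W (e p) - ∑ q, W (e p - e q) * c q := by
  have hL3 : 0 < 2 * L ^ 3 := by positivity
  -- the linear coefficient of the variation along `δ_p` vanishes
  have hD := linear_coeff_eq_zero_of_nonneg (D := 2 * ε p * c p + (2 * L ^ 3)⁻¹ * (-2 * W (e p) +
      ∑ q, (W (e p - e q) + W (e q - e p)) * c q)) (A := ε p + (2 * L ^ 3)⁻¹ * W (e p - e p)) ?_
  · have hsym : ∑ q, (W (e p - e q) + W (e q - e p)) * c q = 2 * ∑ q, W (e p - e q) * c q := by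
      rw [Finset.mul_sum]
      refine Finset.sum_congr rfl fun q _ => ?_
      rw [← neg_sub (e p) (e q), hW]; ring
    rw [hsym] at hD
    field_simp at hD
    linear_combination hD
  · intro t
    have h := hmin (fun q => c q + if q = p then t else 0)
    rw [galerkinEnergy_add_single] at h
    linarith

/-! ### The energy identity and the a priori bounds -/

omit [DecidableEq ι] in
/-- **The energy identity at a critical point**: if the Euler–Lagrange equations hold, then
`E(c) = (2L³)⁻¹ (W(0) - ∑_q W(e q) c_q)` — the functional value equals `½L⁻³ "∫ v f"`, `f = 1 - w`
(stationarity in the direction of `c` itself). [cite: BastiCenatiempoSchlein2021, Lemma 2.1 (ii)] -/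
theorem galerkinEnergy_eq_of_euler_lagrange (hL : 0 < L) {c : ι → ℝ}
    (hEL : ∀ p, 2 * L ^ 3 * ε p * c p = W (e p) - ∑ q, W (e p - e q) * c q) :
    galerkinEnergy e ε W L c = (2 * L ^ 3)⁻¹ * (W 0 - ∑ q, W (e q) * c q) := by
  have hL3 : (2 * L ^ 3) ≠ 0 := by positivity
  -- `2L³ ∑ ε c² = ∑ W c - ∑∑ W c c`
  have hsum : 2 * L ^ 3 * ∑ p, ε p * c p ^ 2 =
      ∑ p, W (e p) * c p - ∑ p, ∑ q, W (e p - e q) * c p * c q := by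
    rw [Finset.mul_sum, ← Finset.sum_sub_distrib]
    refine Finset.sum_congr rfl fun p _ => ?_
    have h := congrArg (fun x => x * c p) (hEL p)
    simp only [sub_mul, Finset.sum_mul] at h
    calc 2 * L ^ 3 * (ε p * c p ^ 2) = 2 * L ^ 3 * ε p * c p * c p := by ring
      _ = W (e p) * c p - ∑ q, W (e p - e q) * c q * c p := h
      _ = _ := by
          congr 1
          exact Finset.sum_congr rfl fun q _ => by ring
  unfold galerkinEnergy galerkinPot
  have h2 : ∑ p, ε p * c p ^ 2 = (2 * L ^ 3)⁻¹ * (∑ p, W (e p) * c p - ∑ p, ∑ q, W (e p - e q) * c p * c q) := by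
    rw [← hsum]; field_simp
  rw [h2]
  ring

omit [DecidableEq ι] in
/-- **The `H¹`-type bound**: with the positivity `∑_{p,q} W(e p - e q)c_pc_q ≥ 0` (Bochner),
`∑_p ε_p c_p² ≤ (2L³)⁻² ∑_p W(e p)²/ε_p` — the analogue of `‖η‖²_{H¹} ≤ CN^{1+κ}`.
[cite: BastiCenatiempoSchlein2021, Lemma 2.2 (`‖η_{L^c}‖²_{H¹}, ‖η_H‖²_{H¹} ≤ CN^{1+κ}`)] -/
theorem sum_eps_mul_sq_le (hL : 0 < L) (hε : ∀ p, 0 < ε p) {c : ι → ℝ}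
    (hEL : ∀ p, 2 * L ^ 3 * ε p * c p = W (e p) - ∑ q, W (e p - e q) * c q)
    (hpos : 0 ≤ ∑ p, ∑ q, W (e p - e q) * c p * c q) :
    ∑ p, ε p * c p ^ 2 ≤ ((2 * L ^ 3) ^ 2)⁻¹ * ∑ p, W (e p) ^ 2 / ε p := by
  set S := ∑ p, ε p * c p ^ 2 with hS
  set A := ∑ p, W (e p) ^ 2 / ε p with hA
  have hS0 : 0 ≤ S := Finset.sum_nonneg fun p _ => mul_nonneg (hε p).le (sq_nonneg _)
  have hA0 : 0 ≤ A := Finset.sum_nonneg fun p _ => div_nonneg (sq_nonneg _) (hε p).le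
  have hL3 : 0 < 2 * L ^ 3 := by positivity
  -- `2L³ S ≤ ∑ |W||c| ≤ √A √S`
  have h1 : 2 * L ^ 3 * S ≤ ∑ p, |W (e p)| * |c p| := by
    have hsum : 2 * L ^ 3 * S = ∑ p, W (e p) * c p - ∑ p, ∑ q, W (e p - e q) * c p * c q := by
      rw [hS, Finset.mul_sum, ← Finset.sum_sub_distrib]
      refine Finset.sum_congr rfl fun p _ => ?_
      have h := congrArg (fun x => x * c p) (hEL p)
      simp only [sub_mul, Finset.sum_mul] at h
      calc 2 * L ^ 3 * (ε p * c p ^ 2) = 2 * L ^ 3 * ε p * c p * c p := by ring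
        _ = W (e p) * c p - ∑ q, W (e p - e q) * c q * c p := h
        _ = _ := by
            congr 1
            exact Finset.sum_congr rfl fun q _ => by ring
    rw [hsum]
    calc ∑ p, W (e p) * c p - ∑ p, ∑ q, W (e p - e q) * c p * c q ≤ ∑ p, W (e p) * c p := by linarith
      _ ≤ ∑ p, |W (e p)| * |c p| := Finset.sum_le_sum fun p _ => by
          rw [← abs_mul]; exact le_abs_self _
  have h2 : (∑ p, |W (e p)| * |c p|) ^ 2 ≤ A * S := by
    have h := Finset.sum_mul_sq_le_sq_mul_sq Finset.univ (fun p => |W (e p)| / Real.sqrt (ε p))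
      (fun p => Real.sqrt (ε p) * |c p|)
    have hf : ∀ p, |W (e p)| / Real.sqrt (ε p) * (Real.sqrt (ε p) * |c p|) = |W (e p)| * |c p| := by
      intro p
      have : Real.sqrt (ε p) ≠ 0 := (Real.sqrt_pos.2 (hε p)).ne'
      field_simp
    have hA' : ∑ p, (|W (e p)| / Real.sqrt (ε p)) ^ 2 = A := by
      rw [hA]; refine Finset.sum_congr rfl fun p _ => ?_
      rw [div_pow, sq_abs, Real.sq_sqrt (hε p).le]
    have hS' : ∑ p, (Real.sqrt (ε p) * |c p|) ^ 2 = S := by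
      rw [hS]; refine Finset.sum_congr rfl fun p _ => ?_
      rw [mul_pow, sq_abs, Real.sq_sqrt (hε p).le]
    simp only [hf] at h
    rwa [hA', hS'] at h
  -- conclude `S ≤ A/(2L³)²`
  have h3 : (2 * L ^ 3 * S) ^ 2 ≤ A * S := by
    calc (2 * L ^ 3 * S) ^ 2 ≤ (∑ p, |W (e p)| * |c p|) ^ 2 :=
          pow_le_pow_left₀ (by positivity) h1 2
      _ ≤ A * S := h2
  rcases hS0.lt_or_eq with hSpos | hS00
  · have h4 : (2 * L ^ 3) ^ 2 * S ≤ A := by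
      have : (2 * L ^ 3) ^ 2 * S * S ≤ A * S := by nlinarith
      exact le_of_mul_le_mul_right this hSpos
    rw [inv_mul_eq_div, le_div_iff₀ (by positivity)]
    linarith
  · rw [← hS00]; positivity

omit [DecidableEq ι] in
/-- **The pointwise bound from the equation**:
`2L³ε_p|c_p| ≤ |W(e p)| + (∑_q W(e p - e q)²/ε_q)^{1/2} (∑_q ε_qc_q²)^{1/2}` — with the `H¹` bound
this is `|η_p| ≤ CN^κ/p²` [(2.4)]. [cite: BastiCenatiempoSchlein2021, (2.4)] -/
theorem abs_eps_mul_le (hε : ∀ p, 0 < ε p) {c : ι → ℝ}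
    (hEL : ∀ p, 2 * L ^ 3 * ε p * c p = W (e p) - ∑ q, W (e p - e q) * c q) (p : ι) :
    |2 * L ^ 3 * ε p * c p| ≤ |W (e p)| +
      Real.sqrt (∑ q, W (e p - e q) ^ 2 / ε q) * Real.sqrt (∑ q, ε q * c q ^ 2) := by
  rw [hEL p]
  refine (abs_sub _ _).trans (add_le_add le_rfl ?_)
  refine (Finset.abs_sum_le_sum_abs _ _).trans ?_
  have h := Finset.sum_mul_sq_le_sq_mul_sq Finset.univ (fun q => |W (e p - e q)| / Real.sqrt (ε q))
    (fun q => Real.sqrt (ε q) * |c q|)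
  have hf : ∀ q, |W (e p - e q)| / Real.sqrt (ε q) * (Real.sqrt (ε q) * |c q|) = |W (e p - e q) * c q| := by
    intro q
    have : Real.sqrt (ε q) ≠ 0 := (Real.sqrt_pos.2 (hε q)).ne'
    rw [abs_mul]; field_simp
  have hA' : ∑ q, (|W (e p - e q)| / Real.sqrt (ε q)) ^ 2 = ∑ q, W (e p - e q) ^ 2 / ε q :=
    Finset.sum_congr rfl fun q _ => by rw [div_pow, sq_abs, Real.sq_sqrt (hε q).le]
  have hS' : ∑ q, (Real.sqrt (ε q) * |c q|) ^ 2 = ∑ q, ε q * c q ^ 2 :=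
    Finset.sum_congr rfl fun q _ => by rw [mul_pow, sq_abs, Real.sq_sqrt (hε q).le]
  simp only [hf] at h
  rw [hA', hS'] at h
  have hnn : 0 ≤ ∑ q, |W (e p - e q) * c q| := Finset.sum_nonneg fun q _ => abs_nonneg _
  rw [← Real.sqrt_mul (Finset.sum_nonneg fun q _ => div_nonneg (sq_nonneg _) (hε q).le),
    Real.le_sqrt hnn (mul_nonneg (Finset.sum_nonneg fun q _ => div_nonneg (sq_nonneg _) (hε q).le)
      (Finset.sum_nonneg fun q _ => mul_nonneg (hε q).le (sq_nonneg _)))]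
  exact h

end Galerkin

/-! ### Bochner positivity of the pair coefficients `W_L = Re potFT v L` -/

section Bochner

variable {ι : Type*} [Fintype ι] {L : ℝ} {v : ℝ → ℝ≥0∞}

/-- `W_L(-k) = conj W_L(k)`. [folklore] -/
theorem potFT_neg (v : ℝ → ℝ≥0∞) (L : ℝ) (k : Momentum) : potFT v L (-k) = conj (potFT v L k) := by
  unfold potFT
  rw [← integral_conj]
  refine integral_congr_ae (Filter.Eventually.of_forall fun z => ?_)
  simp only [map_mul, Complex.conj_ofReal, conj_cellWave]

/-- `Re W_L` is even. [folklore] -/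
theorem re_potFT_neg (v : ℝ → ℝ≥0∞) (L : ℝ) (k : Momentum) : (potFT v L (-k)).re = (potFT v L k).re := by
  rw [potFT_neg, Complex.conj_re]

/-- Each `v(|z|) e_a(z)` is integrable when `∫ v < ∞`. [folklore] -/
theorem integrable_pot_mul_cellWave (hv : Measurable v) (hint : (∫⁻ z : Space, v ‖z‖) ≠ ⊤) (L : ℝ)
    (a : Momentum) : Integrable fun z : Space => ((v ‖z‖).toReal : ℂ) * cellWave L a z := by
  refine ((integrable_pot_toReal hv hint).ofReal).mul_bdd (c := 1)
    (continuous_cellWave L a).aestronglyMeasurable (Filter.Eventually.of_forall fun z => ?_)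
  rw [norm_cellWave]

/-- **Bochner identity**: `∑_{p,q} c_pc_q W_L(e p - e q) = ∫ v(|z|) |∑_p c_p e_{e p}(z)|² dz` for real
coefficients. [folklore] -/
theorem sum_sum_mul_mul_potFT (hv : Measurable v) (hint : (∫⁻ z : Space, v ‖z‖) ≠ ⊤) (L : ℝ)
    (e : ι → Momentum) (c : ι → ℝ) :
    ∑ p, ∑ q, (c p : ℂ) * (c q : ℂ) * potFT v L (e p - e q) =
      ∫ z : Space, ((v ‖z‖).toReal : ℂ) * (((‖∑ p, (c p : ℂ) * cellWave L (e p) z‖ ^ 2 : ℝ)) : ℂ) := by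
  -- expand `|∑ c e|²` and integrate term by term
  have hexp : ∀ z : Space, (((‖∑ p, (c p : ℂ) * cellWave L (e p) z‖ ^ 2 : ℝ)) : ℂ) =
      ∑ p, ∑ q, (c p : ℂ) * (c q : ℂ) * cellWave L (e p - e q) z := by
    intro z
    rw [Complex.ofReal_pow, ← Complex.conj_mul', map_sum, Finset.sum_mul, Finset.sum_comm]
    refine Finset.sum_congr rfl fun p _ => ?_
    rw [Finset.mul_sum]
    refine Finset.sum_congr rfl fun q _ => ?_
    rw [map_mul, Complex.conj_ofReal, conj_cellWave, sub_eq_add_neg, cellWave_add_index]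
    ring
  have hint' : ∀ p q, Integrable (fun z : Space => ((v ‖z‖).toReal : ℂ) *
      ((c p : ℂ) * (c q : ℂ) * cellWave L (e p - e q) z)) := by
    intro p q
    have := (integrable_pot_mul_cellWave hv hint L (e p - e q)).const_mul ((c p : ℂ) * (c q : ℂ))
    refine this.congr (Filter.Eventually.of_forall fun z => ?_)
    simp only
    ring
  simp_rw [hexp, Finset.mul_sum]
  rw [integral_finsetSum _ fun p _ => integrable_finsetSum _ fun q _ => hint' p q]
  refine Finset.sum_congr rfl fun p _ => ?_
  rw [integral_finsetSum _ fun q _ => hint' p q]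
  refine Finset.sum_congr rfl fun q _ => ?_
  unfold potFT
  rw [← integral_const_mul]
  refine integral_congr_ae (Filter.Eventually.of_forall fun z => ?_)
  simp only
  ring

/-- **Bochner positivity**: `∑_{p,q} Re W_L(e p - e q) c_pc_q ≥ 0` for a non-negative radial `v` with
`∫ v < ∞` — the Toeplitz form of the pair coefficients is positive semidefinite.
[cite: BastiCenatiempoSchlein2021, Lemma 2.2 (proof, positivity used implicitly through Lemma 2.1)] -/
theorem sum_sum_re_potFT_mul_mul_nonneg (hv : Measurable v) (hint : (∫⁻ z : Space, v ‖z‖) ≠ ⊤)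
    (L : ℝ) (e : ι → Momentum) (c : ι → ℝ) :
    0 ≤ ∑ p, ∑ q, (potFT v L (e p - e q)).re * c p * c q := by
  have h := congrArg Complex.re (sum_sum_mul_mul_potFT hv hint L e c)
  rw [Complex.re_sum] at h
  have hl : ∑ p, (∑ q, (c p : ℂ) * (c q : ℂ) * potFT v L (e p - e q)).re =
      ∑ p, ∑ q, (potFT v L (e p - e q)).re * c p * c q := by
    refine Finset.sum_congr rfl fun p _ => ?_
    rw [Complex.re_sum]
    refine Finset.sum_congr rfl fun q _ => ?_
    rw [← Complex.ofReal_mul, Complex.re_ofReal_mul]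
    ring
  rw [hl] at h
  rw [h]
  have hpt : ∀ z : Space, ((v ‖z‖).toReal : ℂ) * (((‖∑ p, (c p : ℂ) * cellWave L (e p) z‖ ^ 2 : ℝ)) : ℂ) =
      (((v ‖z‖).toReal * ‖∑ p, (c p : ℂ) * cellWave L (e p) z‖ ^ 2 : ℝ) : ℂ) := by
    intro z; push_cast; ring
  simp_rw [hpt]
  rw [integral_complex_ofReal, Complex.ofReal_re]
  exact integral_nonneg fun z => mul_nonneg ENNReal.toReal_nonneg (sq_nonneg _)

/-- **Positivity of the potential form**: `Q(c) = W(0) - 2∑_q W(e q)c_q + ∑_{p,q} W(e p - e q)c_pc_q ≥ 0`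
for `W = Re W_L` (it is `∫ v |1 - ∑ c_p e_{e p}|²`; obtained from Bochner positivity on `Option ι` with
the extra mode `e = 0`, `c = -1`). [folklore] -/
theorem galerkinPot_re_potFT_nonneg (hv : Measurable v) (hint : (∫⁻ z : Space, v ‖z‖) ≠ ⊤)
    (L : ℝ) (e : ι → Momentum) (c : ι → ℝ) :
    0 ≤ galerkinPot e (fun k => (potFT v L k).re) c := by
  classical
  have h := sum_sum_re_potFT_mul_mul_nonneg hv hint L (fun o : Option ι => o.elim 0 e)
    (fun o : Option ι => o.elim (-1) c)
  rw [Fintype.sum_option] at h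
  simp only [Fintype.sum_option, Option.elim, Finset.sum_add_distrib] at h
  simp only [galerkinPot]
  simp only [zero_sub, sub_zero, re_potFT_neg, sub_self] at h
  have hsym : ∑ x, (potFT v L (e x)).re * c x * (-1) = -∑ q, (potFT v L (e q)).re * c q := by
    rw [← Finset.sum_neg_distrib]; refine Finset.sum_congr rfl fun q _ => ?_; ring
  have hsym' : ∑ x, (potFT v L (e x)).re * (-1) * c x = -∑ q, (potFT v L (e q)).re * c q := by
    rw [← Finset.sum_neg_distrib]; refine Finset.sum_congr rfl fun q _ => ?_; ring
  rw [hsym, hsym'] at h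
  linarith

end Bochner


/-! ### Symmetry: an even minimiser -/

section Even

variable {ι : Type*} [Fintype ι] {e : ι → Momentum} {ε : ι → ℝ} {W : Momentum → ℝ} {L : ℝ}

/-- `Q(c ∘ σ) = Q(c)` for a bijection `σ` of the modes with `e ∘ σ = -e` and `W` even. [folklore] -/
theorem galerkinPot_comp (σ : ι ≃ ι) (heσ : ∀ p, e (σ p) = -e p) (hW : ∀ k, W (-k) = W k) (c : ι → ℝ) :
    galerkinPot e W (c ∘ σ) = galerkinPot e W c := by
  unfold galerkinPot
  have h1 : ∑ q, W (e q) * (c ∘ σ) q = ∑ q, W (e q) * c q := by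
    rw [← Equiv.sum_comp σ.symm]
    refine Finset.sum_congr rfl fun q _ => ?_
    simp only [Function.comp_apply, Equiv.apply_symm_apply]
    have : e (σ.symm q) = -e q := by
      have h := heσ (σ.symm q); rw [Equiv.apply_symm_apply] at h
      have := congrArg Neg.neg h; simpa using this.symm
    rw [this, hW]
  have h2 : ∑ p, ∑ q, W (e p - e q) * (c ∘ σ) p * (c ∘ σ) q = ∑ p, ∑ q, W (e p - e q) * c p * c q := by
    rw [← Equiv.sum_comp σ.symm]
    refine Finset.sum_congr rfl fun p _ => ?_
    rw [← Equiv.sum_comp σ.symm]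
    refine Finset.sum_congr rfl fun q _ => ?_
    simp only [Function.comp_apply, Equiv.apply_symm_apply]
    have hp : e (σ.symm p) = -e p := by
      have h := heσ (σ.symm p); rw [Equiv.apply_symm_apply] at h
      have := congrArg Neg.neg h; simpa using this.symm
    have hq : e (σ.symm q) = -e q := by
      have h := heσ (σ.symm q); rw [Equiv.apply_symm_apply] at h
      have := congrArg Neg.neg h; simpa using this.symm
    rw [hp, hq, show -e p - -e q = -(e p - e q) by abel, hW]
  rw [h1, h2]

/-- `E(c ∘ σ) = E(c)` when moreover `ε ∘ σ = ε`. [folklore] -/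
theorem galerkinEnergy_comp (σ : ι ≃ ι) (heσ : ∀ p, e (σ p) = -e p) (hεσ : ∀ p, ε (σ p) = ε p)
    (hW : ∀ k, W (-k) = W k) (c : ι → ℝ) :
    galerkinEnergy e ε W L (c ∘ σ) = galerkinEnergy e ε W L c := by
  unfold galerkinEnergy
  rw [galerkinPot_comp σ heσ hW]
  congr 1
  rw [← Equiv.sum_comp σ.symm]
  refine Finset.sum_congr rfl fun p _ => ?_
  simp only [Function.comp_apply, Equiv.apply_symm_apply]
  have := hεσ (σ.symm p); rw [Equiv.apply_symm_apply] at this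
  rw [this]

/-- The Euler–Lagrange system is affine: it passes to midpoints. [folklore] -/
theorem euler_lagrange_midpoint {c d : ι → ℝ}
    (hc : ∀ p, 2 * L ^ 3 * ε p * c p = W (e p) - ∑ q, W (e p - e q) * c q)
    (hd : ∀ p, 2 * L ^ 3 * ε p * d p = W (e p) - ∑ q, W (e p - e q) * d q) (p : ι) :
    2 * L ^ 3 * ε p * ((c p + d p) / 2) = W (e p) - ∑ q, W (e p - e q) * ((c q + d q) / 2) := by
  have h1 := hc p; have h2 := hd p
  have hs : ∑ q, W (e p - e q) * ((c q + d q) / 2) =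
      (∑ q, W (e p - e q) * c q + ∑ q, W (e p - e q) * d q) / 2 := by
    rw [← Finset.sum_add_distrib, Finset.sum_div]
    refine Finset.sum_congr rfl fun q _ => ?_; ring
  rw [hs]
  linarith

/-- **Midpoint convexity** of `E` from `ε ≥ 0` and Bochner positivity (applied to `c - d`):
`E((c+d)/2) ≤ (E(c) + E(d))/2`. [folklore] -/
theorem galerkinEnergy_midpoint_le (hL : 0 < L) (hε : ∀ p, 0 ≤ ε p) {c d : ι → ℝ}
    (hpos : 0 ≤ ∑ p, ∑ q, W (e p - e q) * (c p - d p) * (c q - d q)) :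
    galerkinEnergy e ε W L (fun p => (c p + d p) / 2) ≤
      (galerkinEnergy e ε W L c + galerkinEnergy e ε W L d) / 2 := by
  unfold galerkinEnergy galerkinPot
  have hL3 : 0 ≤ (2 * L ^ 3)⁻¹ := by positivity
  -- kinetic part: `ε((c+d)/2)² ≤ (εc² + εd²)/2`
  have hkin : ∑ p, ε p * ((c p + d p) / 2) ^ 2 ≤ (∑ p, ε p * c p ^ 2 + ∑ p, ε p * d p ^ 2) / 2 := by
    rw [← Finset.sum_add_distrib, Finset.sum_div]
    refine Finset.sum_le_sum fun p _ => ?_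
    have := hε p
    nlinarith [sq_nonneg (c p - d p), mul_nonneg this (sq_nonneg (c p - d p))]
  -- potential part: exact identity plus Bochner
  have hlin : ∑ q, W (e q) * ((c q + d q) / 2) = (∑ q, W (e q) * c q + ∑ q, W (e q) * d q) / 2 := by
    rw [← Finset.sum_add_distrib, Finset.sum_div]
    refine Finset.sum_congr rfl fun q _ => ?_; ring
  have hquad : 4 * ∑ p, ∑ q, W (e p - e q) * ((c p + d p) / 2) * ((c q + d q) / 2) =
      2 * (∑ p, ∑ q, W (e p - e q) * c p * c q + ∑ p, ∑ q, W (e p - e q) * d p * d q) -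
      ∑ p, ∑ q, W (e p - e q) * (c p - d p) * (c q - d q) := by
    rw [mul_add, Finset.mul_sum, Finset.mul_sum, Finset.mul_sum, ← Finset.sum_add_distrib,
      ← Finset.sum_sub_distrib]
    refine Finset.sum_congr rfl fun p _ => ?_
    rw [Finset.mul_sum, Finset.mul_sum, Finset.mul_sum, ← Finset.sum_add_distrib, ← Finset.sum_sub_distrib]
    refine Finset.sum_congr rfl fun q _ => ?_
    ring
  set Km := ∑ p, ε p * ((c p + d p) / 2) ^ 2
  set Kc := ∑ p, ε p * c p ^ 2
  set Kd := ∑ p, ε p * d p ^ 2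
  set Lm := ∑ q, W (e q) * ((c q + d q) / 2)
  set Lc := ∑ q, W (e q) * c q
  set Ld := ∑ q, W (e q) * d q
  set Qm := ∑ p, ∑ q, W (e p - e q) * ((c p + d p) / 2) * ((c q + d q) / 2)
  set Qc := ∑ p, ∑ q, W (e p - e q) * c p * c q
  set Qd := ∑ p, ∑ q, W (e p - e q) * d p * d q
  set D := ∑ p, ∑ q, W (e p - e q) * (c p - d p) * (c q - d q)
  set k := (2 * L ^ 3)⁻¹
  have hQm : Qm ≤ (Qc + Qd) / 2 := by linarith
  have hk : k * (W 0 - 2 * Lm + Qm) ≤ k * (W 0 - (Lc + Ld) + (Qc + Qd) / 2) := by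
    refine mul_le_mul_of_nonneg_left ?_ hL3
    rw [hlin]; linarith
  linarith

/-- **An even Galerkin minimiser satisfying the scattering equation.** For a mode bijection `σ`
with `e ∘ σ = -e`, `ε ∘ σ = ε`, an even `W` with Bochner positivity, `ε ≥ m > 0`, `Q ≥ 0`, `L > 0`:
there is a minimiser `c` with `c ∘ σ = c` (so `η_{-p} = η_p`), and it satisfies the Euler–Lagrange
system `2L³ε_pc_p = W(e p) - ∑_q W(e p - e q)c_q` on every mode. (Symmetrise any minimiser: the
midpoint of `c` and `c ∘ σ` is again a minimiser by convexity.)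
[cite: BastiCenatiempoSchlein2021, (2.3)–(2.5) (`η_p = η_{-p}` real, the scattering equation)] -/
theorem exists_even_minimiser [DecidableEq ι] (hL : 0 < L) {m : ℝ} (hm0 : 0 < m) (hm : ∀ p, m ≤ ε p)
    (hQ : ∀ c, 0 ≤ galerkinPot e W c)
    (hpos : ∀ c : ι → ℝ, 0 ≤ ∑ p, ∑ q, W (e p - e q) * c p * c q)
    (σ : ι ≃ ι) (hσ : ∀ p, σ (σ p) = p) (heσ : ∀ p, e (σ p) = -e p) (hεσ : ∀ p, ε (σ p) = ε p)
    (hW : ∀ k, W (-k) = W k) :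
    ∃ c : ι → ℝ, (∀ c', galerkinEnergy e ε W L c ≤ galerkinEnergy e ε W L c') ∧ (∀ p, c (σ p) = c p) ∧
      ∀ p, 2 * L ^ 3 * ε p * c p = W (e p) - ∑ q, W (e p - e q) * c q := by
  obtain ⟨c₀, hc₀⟩ := exists_isMinOn_galerkinEnergy hL hm0 hm hQ
  refine ⟨fun p => (c₀ p + (c₀ ∘ σ) p) / 2, ?_, ?_, ?_⟩
  · intro c'
    have h1 := galerkinEnergy_midpoint_le (e := e) (W := W) (L := L) hL (fun p => hm0.le.trans (hm p))
      (c := c₀) (d := c₀ ∘ σ) (hpos _)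
    have h2 : galerkinEnergy e ε W L (c₀ ∘ σ) = galerkinEnergy e ε W L c₀ := galerkinEnergy_comp σ heσ hεσ hW c₀
    have h3 := hc₀ c'
    simp only [Function.comp_apply] at h1 h2 ⊢
    linarith
  · intro p
    simp only [Function.comp_apply, hσ]
    ring
  · have hEL := galerkin_euler_lagrange hL hW hc₀
    have hEL' : ∀ p, 2 * L ^ 3 * ε p * (c₀ ∘ σ) p = W (e p) - ∑ q, W (e p - e q) * (c₀ ∘ σ) q := by
      have hmin' : ∀ c', galerkinEnergy e ε W L (c₀ ∘ σ) ≤ galerkinEnergy e ε W L c' := by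
        intro c'; rw [galerkinEnergy_comp σ heσ hεσ hW c₀]; exact hc₀ c'
      exact galerkin_euler_lagrange hL hW hmin'
    exact euler_lagrange_midpoint hEL hEL'

end Even

end Literature.MathematicalPhysics.QuantumManyBody.BoseGas

end
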